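import Summits.CriticalPhenomena.PercolationContinuityZ3.Theorems.SoloInformedAnchoredGluing
import Summits.CriticalPhenomena.PercolationContinuityZ3.Theorems.SoloInformedOuterplaneAnchors
import Literature.Probability.LatticeModels.ProdBernoulliClusterLocality
import HarnessLib

/-!
# Kozma–Nitzan's Conjecture 3 for outerplane weighted graphs, uniformly in `|A|`

Solo census (`solo-CriticalPhenomena-informed`). For *outerplane weights* on `Fin n` — edges of
non-zero weight are pairwise non-crossing chords of the circle through `0, …, n-1`
(`outerplaneWeights`) — the first target met from `o` towards `b` along either boundary arc is an
anchor for all targets of its arc: almost surely `{o ↔ a} ∩ {c ↔ b} ⊆ {o ↔ b}`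
(`ae_glue_of_interlaced`, from the combinatorial Jordan lemma `exists_mem_support_inter` and the
a.s. absence of zero-weight open edges). With the four-anchor cover (`anchors_of_lt/gt`) and the
anchored Harris bound (`conjecture3_of_anchors`) this proves

  `conjecture3_outerplane : ∀ ε > 0, ∃ δ > 0, ∀ n w, w ∈ outerplaneWeights n → ∀ A o b, o ∉ A →
     1-δ < P(o ↔ A) → (∀ a ∈ A, 1-δ < P(a ↔ b)) → 1-ε < P(o ↔ b)`      (`δ = ε/6`):

Kozma–Nitzan's Conjecture 3 (arXiv:2401.12397 p. 15; tree: `KozmaNitzan2024_conjecture3`)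
restricted to outerplane weighted graphs, with ONE `δ(ε)` for all `n`, all weights and all `|A|`.
The instances their renormalisation consumes in `ℤ³` (tree: `KozmaNitzan2024_thm6_three`) have
unbounded anchoring number; the planar-boundary class is exactly where gluing is free.
-/

noncomputable section

namespace Summit.CriticalPhenomena.PercolationContinuityZ3.Theorems

open MeasureTheory Literature.Probability.Percolation Literature.Probability.LatticeModels

variable {n : ℕ}

/-- **Outerplane weights** on `Fin n`: edges of non-zero weight, read as chords of the circle
through `0, 1, …, n-1`, pairwise do not cross (vertex-disjoint chords see each other from one
side). Every weighted outerplanar graph, drawn with all vertices on the outer face, is of this form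
after relabelling. -/
def outerplaneWeights (n : ℕ) : Set (Sym2 (Fin n) → unitInterval) :=
  {w | ∀ u v x y : Fin n, w s(u, v) ≠ 0 → w s(x, y) ≠ 0 → x ≠ u → x ≠ v → y ≠ u → y ≠ v →
    sep x u v = sep y u v}

/-- Almost surely every open edge has non-zero weight. -/
theorem ae_openGraph_adj_ne_zero (w : Sym2 (Fin n) → unitInterval) :
    ∀ᵐ ω ∂(prodBernoulli w), ∀ u v : Fin n, (openGraph ω).Adj u v → w s(u, v) ≠ 0 := by
  have h := prodBernoulli_ae_forall_notMem w (Z := {e | w e = 0}) (Set.to_countable _)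
    (fun e he => he)
  filter_upwards [h] with ω hω u v hadj hw
  rw [openGraph_adj] at hadj
  exact hω _ hw hadj.1

/-- **Interlaced boundary pairs glue (a.s.).** For outerplane weights, if exactly one of `c, b` lies
strictly between `o` and `a`, then almost surely `{o ↔ a} ∩ {c ↔ b} ⊆ {o ↔ b}`. -/
theorem ae_glue_of_interlaced (w : Sym2 (Fin n) → unitInterval) (hw : w ∈ outerplaneWeights n)
    {o a c b : Fin n} (hint : sep c o a ≠ sep b o a) :
    ∀ᵐ ω ∂(prodBernoulli w), ω ∈ openConn o a → ω ∈ openConn c b → ω ∈ openConn o b := by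
  classical
  filter_upwards [ae_openGraph_adj_ne_zero w] with ω hω hoa hcb
  obtain ⟨p⟩ := hoa
  obtain ⟨q⟩ := hcb
  have hnc : ∀ u v x y, (openGraph ω).Adj u v → (openGraph ω).Adj x y → u ∈ p.support →
      v ∈ p.support → x ∉ p.support → y ∉ p.support → sep x u v = sep y u v := by
    intro u v x y huv hxy hu hv hx hy
    have hw' : ∀ u v x y : Fin n, w s(u, v) ≠ 0 → w s(x, y) ≠ 0 → x ≠ u → x ≠ v → y ≠ u → y ≠ v →
        sep x u v = sep y u v := hw
    refine hw' u v x y (hω u v huv) (hω x y hxy) ?_ ?_ ?_ ?_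
    · rintro rfl; exact hx hu
    · rintro rfl; exact hx hv
    · rintro rfl; exact hy hu
    · rintro rfl; exact hy hv
  obtain ⟨v, hvp, hvq⟩ := exists_mem_support_inter p q hint hnc
  exact ⟨(p.takeUntil v hvp).append (q.dropUntil v hvq)⟩
/-- **Kozma–Nitzan Conjecture 3 for outerplane (convex) weighted graphs, uniformly in `|A|` and in
the graph** (`δ = ε/6`): for every `ε > 0` there is `δ > 0` such that for all `n`, all outerplane
weights on `Fin n`, all `A ∌ o` and all `b`, the hypotheses `P(o ↔ A) > 1-δ` and
`P(a ↔ b) > 1-δ (a ∈ A)` force `P(o ↔ b) > 1-ε`. This is the case of Kozma–Nitzan's conjecture in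
which the same-`p` gluing is done by planarity (interlaced boundary pairs); the instances their
renormalisation needs in `ℤ³` have unbounded anchoring number. -/
theorem conjecture3_outerplane (ε : ℝ) (hε : 0 < ε) :
    ∃ δ : ℝ, 0 < δ ∧ ∀ (n : ℕ) (w : Sym2 (Fin n) → unitInterval), w ∈ outerplaneWeights n →
      ∀ (A : Finset (Fin n)) (o b : Fin n), o ∉ A →
      1 - δ < (prodBernoulli w).real (⋃ a ∈ A, openConn o a) →
        (∀ a ∈ A, 1 - δ < (prodBernoulli w).real (openConn a b)) →
          1 - ε < (prodBernoulli w).real (openConn o b) := by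
  obtain ⟨δ, hδ, H⟩ := conjecture3_of_anchors 4 ε hε
  refine ⟨δ, hδ, ?_⟩
  intro n w hw A o b ho hA hb
  have hglue_of : ∀ (Anc : Finset (Fin n)) (part : Fin n → Finset (Fin n)),
      (∀ c ∈ Anc, ∀ a ∈ part c, a = c ∨ sep c o a ≠ sep b o a) →
      ∀ c ∈ Anc, ∀ a ∈ part c, ∀ᵐ ω ∂(prodBernoulli w),
        ω ∈ openConn o a → ω ∈ openConn c b → ω ∈ openConn o b := by
    intro Anc part hg c hc a ha
    rcases hg c hc a ha with rfl | hint
    · exact ae_of_all _ fun ω h1 h2 => glue_self o a b ⟨h1, h2⟩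
    · exact ae_glue_of_interlaced w hw hint
  rcases lt_trichotomy o b with hob | rfl | hbo
  · obtain ⟨Anc, hsub, hcard, part, hcov, hg⟩ := anchors_of_lt A ho hob
    exact H n w A Anc part o b hcard hsub hcov (hglue_of Anc part hg) hA hb
  · have h1 : (prodBernoulli w).real (openConn o o) = 1 := by
      have : (openConn o o : Set (BondConfig (Fin n))) = Set.univ :=
        Set.eq_univ_of_forall fun ω => SimpleGraph.Reachable.refl o
      rw [this, probReal_univ]
    linarith
  · obtain ⟨Anc, hsub, hcard, part, hcov, hg⟩ := anchors_of_gt A ho hbo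
    exact H n w A Anc part o b hcard hsub hcov (hglue_of Anc part hg) hA hb

end Summit.CriticalPhenomena.PercolationContinuityZ3.Theorems
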